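import Summits.ValiantsHypothesis.ValiantsHypothesis.Theorems.LacunarySymmetroidMatrixDescartesOverlapSector

/-!
# `MatrixDescartes` — the OVERLAP WINDOW LAW, two-survivor form: one window per hand-over / cluster

HONEST FRAMING.  Object-search cell `pub-symmetroid`, crux `Theses.LacunarySymmetroid.MatrixDescartes` (ledger item
`stmt-ValiantsHypothesis-18050`, route `LacunarySymmetroid`; seat `val-sym-mdr-p2`, gen 13).  The crux implies `VP ≠ VNP`
by the route's assembly; NOTHING here is progress on it, and nothing here is a claim about `VP ≠ VNP`, `DoorA26` /
`DoorA34` or the cell's registers.  Sequel of `…RobustDescartes` / `…OverlapWindow` / `…OverlapSector`.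

WHY.  The one-survivor law (`Overlap.card_roots_Icc_le_of_liveSet`) keeps ONE pure power `det S t·X^(m d t)` (`t` of extreme
exponent in the live set) and compares the weighted tail with it at BOTH endpoints of the window; across a hand-over of
dominance the survivor is the weak letter at one of the two ends (by the factor `(x/x_h)^(g·m)`), so in practice each
hand-over or cluster needs two windows (bottom-survivor half, top-survivor half) and costs `2(#E_L − 1)` (located on
two-triad `m = 2` designs, seat folder `exp/overlap_check.py`: one-survivor margins `10⁻¹³ … 10⁻⁶⁰` at the far endpoint;
with the two-survivor form below, `exp/overlap_check2.py` certifies `Z₊ ≤ 8–9 < 20 = C(7,2) − 1` with ONE window per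
cluster / hand-over on all seeds once the inter-cluster hand-over ratio is `≥ 10⁴`, exact rational arithmetic).
THE TWO-SURVIVOR LAW (`card_roots_Icc_le_of_twoSurvivors`).  Keep BOTH pure powers — the bottom letter `b` (smallest live
exponent) and the top letter `t` (largest) — and cut (real cuts `A`) every OTHER live exponent.  If the two surviving cut
coefficients `det S b·∏(m d b − α)` and `det S t·∏(m d t − α)` have the SAME SIGN (a PARITY condition on `#A` and the signs
of `det S b`, `det S t`; one extra cut strictly between the two pure exponents flips it, Laguerre's device), then the
cut determinant is `T_b + T_t + tail` with `|T_b + T_t| = |T_b| + |T_t|`, and it is zero-free on `[u, v]` as soon as,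
for some split point `u ≤ c ≤ v`, the weighted tail is below `|T_b|` at `u` and `c` and below `|T_t|` at `c` and `v`
(convexity transport on each half) — the bottom letter guards the left half, the top letter the right half, ONE Rolle
count for the whole window: `≤ #A` zeros, i.e. `#E_L − 2` (+1 for parity) instead of `2(#E_L − 1)`.  For a hand-over of
two letters (`#E_L = m + 1`): `m − 1` or `m` per hand-over in ONE window.
GLUE (`card_posRoots_le_of_windowBounds`): any per-window root bounds on a monotone chain plus root-free rays add up —
so covers may mix one-survivor, two-survivor and Rouché (gen 12) windows.  ARBITRARY real letters; no symmetry used.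
[folklore] (Laguerre's method: Pólya–Szegő V.77).
-/

-- `Summit.ValiantsHypothesis.ValiantsHypothesis.…` repeats a component by the D-0017 layout (single-conjunct summit).
set_option linter.dupNamespace false

namespace Summit.ValiantsHypothesis.ValiantsHypothesis.Theorems.LacunarySymmetroidMatrixDescartes.Overlap

open Polynomial Finset Set
open scoped BigOperators Matrix

variable {K m : ℕ}

/-! ## §9 The two-survivor window law -/

/-- same-sign terms: `0 ≤ a·b` ⇒ `|a + b| = |a| + |b|`. [folklore] -/
theorem abs_add_eq_of_mul_nonneg {a b : ℝ} (h : 0 ≤ a * b) : |a + b| = |a| + |b| := by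
  rcases mul_nonneg_iff.1 h with ⟨ha, hb⟩ | ⟨ha, hb⟩
  · rw [abs_of_nonneg ha, abs_of_nonneg hb, abs_of_nonneg (add_nonneg ha hb)]
  · rw [abs_of_nonpos ha, abs_of_nonpos hb, abs_of_nonpos (add_nonpos ha hb), neg_add]

/-- **OVERLAP WINDOW LAW, two-survivor form.**  `F = ∑ₗ X^(d l) • S l` ANY real `m × m` lacunary pencil; window
`[u, v] ∋ c` (`0 < u ≤ c ≤ v`); live set `L` with two distinct survivors `b, t ∈ L`; real cuts `A` containing the
exponent of every live map other than `f ≡ b`, `f ≡ t`; PARITY: the surviving cut coefficients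
`det S b·∏_{α∈A}(m·d b − α)` and `det S t·∏_{α∈A}(m·d t − α)` have a non-negative product.  If the `|∏(e f − α)|`-weighted
absolute mass of the non-live row-choice terms is below `|∏(m d b − α)|·|det S b|·x^(m d b)` at `x = u, c` and below
`|∏(m d t − α)|·|det S t|·x^(m d t)` at `x = c, v`, then `det F` has at most `#A` distinct zeros in `[u, v]`. [folklore] -/
theorem card_roots_Icc_le_of_twoSurvivors (d : Fin K → ℕ) (S : Fin K → Matrix (Fin m) (Fin m) ℝ)
    (L : Finset (Fin K)) (b t : Fin K) (hb : b ∈ L) (ht : t ∈ L) (hbt : b ≠ t) (A : Finset ℝ)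
    (hA : ∀ f : Fin m → Fin K, (∀ i, f i ∈ L) → (∃ i, f i ≠ b) → (∃ i, f i ≠ t) →
      (((∑ i, d (f i) : ℕ) : ℝ)) ∈ A)
    (hsign : 0 ≤ ((S b).det * ∏ α ∈ A, (((m * d b : ℕ) : ℝ) - α)) *
      ((S t).det * ∏ α ∈ A, (((m * d t : ℕ) : ℝ) - α)))
    {u c v : ℝ} (hu : 0 < u) (huc : u ≤ c) (hcv : c ≤ v)
    (hdom_b : ∀ x : ℝ, (x = u ∨ x = c) →
      ∑ f ∈ Finset.univ.filter (fun f : Fin m → Fin K => ¬ ∀ i, f i ∈ L),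
        |∏ α ∈ A, ((((∑ i, d (f i) : ℕ) : ℝ)) - α)| * |Matrix.det (Matrix.of fun i j => S (f i) i j)| *
          x ^ (∑ i, d (f i))
      < |∏ α ∈ A, (((m * d b : ℕ) : ℝ) - α)| * |(S b).det| * x ^ (m * d b))
    (hdom_t : ∀ x : ℝ, (x = c ∨ x = v) →
      ∑ f ∈ Finset.univ.filter (fun f : Fin m → Fin K => ¬ ∀ i, f i ∈ L),
        |∏ α ∈ A, ((((∑ i, d (f i) : ℕ) : ℝ)) - α)| * |Matrix.det (Matrix.of fun i j => S (f i) i j)| *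
          x ^ (∑ i, d (f i))
      < |∏ α ∈ A, (((m * d t : ℕ) : ℝ) - α)| * |(S t).det| * x ^ (m * d t)) :
    ((Matrix.det (∑ l, ((X : ℝ[X]) ^ d l) • (S l).map C)).roots.toFinset.filter
        (fun x => x ∈ Icc u v)).card ≤ A.card := by
  classical
  -- `m = 0`: the determinant is `1`, no roots
  rcases Nat.eq_zero_or_pos m with hm0 | hmpos
  · subst hm0
    rw [Matrix.det_isEmpty, roots_one]
    simp
  rw [det_pencil_eq_sum_C_mul_X_pow]
  have hkill : ∀ f : Fin m → Fin K, (∀ i, f i ∈ L) → (∃ i, f i ≠ b) → (∃ i, f i ≠ t) →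
      ∏ α ∈ A, (((∑ i, d (f i) : ℕ) : ℝ) - α) = 0 := fun f hf hb' ht' =>
    Finset.prod_eq_zero (hA f hf hb' ht') (sub_self _)
  refine RobustDescartes.card_roots_Icc_le_card_cuts Finset.univ _ _ A hu (huc.trans hcv) fun x hx => ?_
  have hx0 : 0 ≤ x := hu.le.trans hx.1
  rw [RobustDescartes.eval_sum_C_mul_X_pow,
    ← Finset.sum_filter_add_sum_filter_not Finset.univ (fun f : Fin m → Fin K => ∀ i, f i ∈ L)]
  -- the live part is the two survivor terms
  set liveS := Finset.univ.filter (fun f : Fin m → Fin K => ∀ i, f i ∈ L) with hliveS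
  have hcb : (fun _ : Fin m => b) ∈ liveS := by
    rw [hliveS, Finset.mem_filter]; exact ⟨Finset.mem_univ _, fun _ => hb⟩
  have hct : (fun _ : Fin m => t) ∈ liveS.erase (fun _ : Fin m => b) := by
    rw [Finset.mem_erase, hliveS, Finset.mem_filter]
    exact ⟨fun h => hbt (congrFun h ⟨0, hmpos⟩).symm, Finset.mem_univ _, fun _ => ht⟩
  have hNb : (Matrix.of fun i j => S ((fun _ : Fin m => b) i) i j) = S b := by ext i j; rfl
  have hNt : (Matrix.of fun i j => S ((fun _ : Fin m => t) i) i j) = S t := by ext i j; rfl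
  have heb : (∑ i : Fin m, d ((fun _ : Fin m => b) i)) = m * d b := by
    rw [Finset.sum_const, Finset.card_univ, Fintype.card_fin, smul_eq_mul]
  have het : (∑ i : Fin m, d ((fun _ : Fin m => t) i)) = m * d t := by
    rw [Finset.sum_const, Finset.card_univ, Fintype.card_fin, smul_eq_mul]
  set Wb : ℝ := ∏ α ∈ A, (((m * d b : ℕ) : ℝ) - α) with hWb
  set Wt : ℝ := ∏ α ∈ A, (((m * d t : ℕ) : ℝ) - α) with hWt
  have hlive : ∑ f ∈ liveS,
      Matrix.det (Matrix.of fun i j => S (f i) i j) * (∏ α ∈ A, (((∑ i, d (f i) : ℕ) : ℝ) - α)) *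
        x ^ (∑ i, d (f i))
      = (S b).det * Wb * x ^ (m * d b) + (S t).det * Wt * x ^ (m * d t) := by
    rw [← Finset.add_sum_erase liveS _ hcb, ← Finset.add_sum_erase _ _ hct]
    have hrest : ∑ f ∈ (liveS.erase (fun _ : Fin m => b)).erase (fun _ : Fin m => t),
        Matrix.det (Matrix.of fun i j => S (f i) i j) * (∏ α ∈ A, (((∑ i, d (f i) : ℕ) : ℝ) - α)) *
          x ^ (∑ i, d (f i)) = 0 := by
      refine Finset.sum_eq_zero fun f hf => ?_
      rw [Finset.mem_erase, Finset.mem_erase, hliveS, Finset.mem_filter] at hf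
      obtain ⟨hne_t, hne_b, -, hfl⟩ := hf
      have hb' : ∃ i, f i ≠ b := by
        by_contra h; push Not at h; exact hne_b (funext h)
      have ht' : ∃ i, f i ≠ t := by
        by_contra h; push Not at h; exact hne_t (funext h)
      rw [hkill f hfl hb' ht', mul_zero, zero_mul]
    rw [hrest, add_zero, hNb, hNt, heb, het]
  rw [hlive]
  set Tb : ℝ := (S b).det * Wb * x ^ (m * d b) with hTb
  set Tt : ℝ := (S t).det * Wt * x ^ (m * d t) with hTt
  -- same sign
  have hTT : 0 ≤ Tb * Tt := by
    have : Tb * Tt = ((S b).det * Wb * ((S t).det * Wt)) * (x ^ (m * d b) * x ^ (m * d t)) := by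
      rw [hTb, hTt]; ring
    rw [this]
    exact mul_nonneg hsign (mul_nonneg (pow_nonneg hx0 _) (pow_nonneg hx0 _))
  have habs : |Tb + Tt| = |Tb| + |Tt| := abs_add_eq_of_mul_nonneg hTT
  have hTb_abs : |Tb| = |Wb| * |(S b).det| * x ^ (m * d b) := by
    rw [hTb, abs_mul, abs_mul, abs_of_nonneg (pow_nonneg hx0 _)]; ring
  have hTt_abs : |Tt| = |Wt| * |(S t).det| * x ^ (m * d t) := by
    rw [hTt, abs_mul, abs_mul, abs_of_nonneg (pow_nonneg hx0 _)]; ring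
  -- the tail
  have hwpos : ∀ f : Fin m → Fin K,
      0 ≤ |∏ α ∈ A, (((∑ i, d (f i) : ℕ) : ℝ) - α)| * |Matrix.det (Matrix.of fun i j => S (f i) i j)| :=
    fun f => mul_nonneg (abs_nonneg _) (abs_nonneg _)
  have htail : |∑ f ∈ Finset.univ.filter (fun f : Fin m → Fin K => ¬ ∀ i, f i ∈ L),
      Matrix.det (Matrix.of fun i j => S (f i) i j) * (∏ α ∈ A, (((∑ i, d (f i) : ℕ) : ℝ) - α)) *
        x ^ (∑ i, d (f i))|
      ≤ ∑ f ∈ Finset.univ.filter (fun f : Fin m → Fin K => ¬ ∀ i, f i ∈ L),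
          |∏ α ∈ A, (((∑ i, d (f i) : ℕ) : ℝ) - α)| * |Matrix.det (Matrix.of fun i j => S (f i) i j)| *
            x ^ (∑ i, d (f i)) := by
    refine (Finset.abs_sum_le_sum_abs _ _).trans (le_of_eq (Finset.sum_congr rfl fun f _ => ?_))
    rw [abs_mul, abs_mul, abs_of_nonneg (pow_nonneg hx0 _)]
    ring
  -- on each half the corresponding survivor dominates the tail
  have hlt : ∑ f ∈ Finset.univ.filter (fun f : Fin m → Fin K => ¬ ∀ i, f i ∈ L),
      |∏ α ∈ A, (((∑ i, d (f i) : ℕ) : ℝ) - α)| * |Matrix.det (Matrix.of fun i j => S (f i) i j)| *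
        x ^ (∑ i, d (f i)) < |Tb| + |Tt| := by
    rcases le_total x c with hxc | hcx
    · have h := RobustDescartes.sum_mul_pow_lt_of_endpoints
        (Finset.univ.filter (fun f : Fin m → Fin K => ¬ ∀ i, f i ∈ L))
        (fun f => |∏ α ∈ A, (((∑ i, d (f i) : ℕ) : ℝ) - α)| * |Matrix.det (Matrix.of fun i j => S (f i) i j)|)
        (fun f _ => hwpos f) (fun f => ∑ i, d (f i)) (m * d b) hu hx.1 hxc
        (hdom_b u (Or.inl rfl)) (hdom_b c (Or.inr rfl))
      rw [hTb_abs]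
      linarith [abs_nonneg Tt]
    · have h := RobustDescartes.sum_mul_pow_lt_of_endpoints
        (Finset.univ.filter (fun f : Fin m → Fin K => ¬ ∀ i, f i ∈ L))
        (fun f => |∏ α ∈ A, (((∑ i, d (f i) : ℕ) : ℝ) - α)| * |Matrix.det (Matrix.of fun i j => S (f i) i j)|)
        (fun f _ => hwpos f) (fun f => ∑ i, d (f i)) (m * d t) (hu.trans_le huc) hcx hx.2
        (hdom_t c (Or.inl rfl)) (hdom_t v (Or.inr rfl))
      rw [hTt_abs]
      linarith [abs_nonneg Tb]
  intro h0
  have h1 : Tb + Tt = -(∑ f ∈ Finset.univ.filter (fun f : Fin m → Fin K => ¬ ∀ i, f i ∈ L),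
      Matrix.det (Matrix.of fun i j => S (f i) i j) * (∏ α ∈ A, (((∑ i, d (f i) : ℕ) : ℝ) - α)) *
        x ^ (∑ i, d (f i))) := by linarith
  have h2 : |Tb + Tt| ≤ ∑ f ∈ Finset.univ.filter (fun f : Fin m → Fin K => ¬ ∀ i, f i ∈ L),
      |∏ α ∈ A, (((∑ i, d (f i) : ℕ) : ℝ) - α)| * |Matrix.det (Matrix.of fun i j => S (f i) i j)| *
        x ^ (∑ i, d (f i)) := by
    rw [h1, abs_neg]; exact htail
  rw [habs] at h2
  linarith

/-! ## §10 Glue: arbitrary per-window bounds on a chain -/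

/-- **Window glue.**  On a chain `p 0, …, p N` (monotone in practice) with root-free rays `(0, p 0]` and `[p N, ∞)`, any bounds
`B j` for the distinct zeros of `det F` in the windows `[p j.castSucc, p j.succ]` add up: `Z₊ ≤ ∑ⱼ B j`.  (Mix one-survivor,
two-survivor and Rouché windows at will.) [folklore] -/
theorem card_posRoots_le_of_windowBounds (d : Fin K → ℕ) (S : Fin K → Matrix (Fin m) (Fin m) ℝ) {N : ℕ}
    (p : Fin (N + 1) → ℝ) (B : Fin N → ℕ)
    (hwin : ∀ j, ((Matrix.det (∑ l, ((X : ℝ[X]) ^ d l) • (S l).map C)).roots.toFinset.filter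
        (fun x => x ∈ Icc (p j.castSucc) (p j.succ))).card ≤ B j)
    (hbelow : ∀ x : ℝ, 0 < x → x ≤ p 0 → ¬ (Matrix.det (∑ l, ((X : ℝ[X]) ^ d l) • (S l).map C)).IsRoot x)
    (habove : ∀ x : ℝ, p (Fin.last N) ≤ x → ¬ (Matrix.det (∑ l, ((X : ℝ[X]) ^ d l) • (S l).map C)).IsRoot x) :
    ((Matrix.det (∑ l, ((X : ℝ[X]) ^ d l) • (S l).map C)).roots.toFinset.filter (fun x => 0 < x)).card
      ≤ ∑ j, B j := by
  classical
  set F : ℝ[X] := Matrix.det (∑ l, ((X : ℝ[X]) ^ d l) • (S l).map C) with hFdef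
  by_cases hF0 : F = 0
  · rw [hF0, roots_zero, Multiset.toFinset_zero, Finset.filter_empty, Finset.card_empty]; exact Nat.zero_le _
  have hsub : F.roots.toFinset.filter (fun x => 0 < x) ⊆
      (Finset.univ : Finset (Fin N)).biUnion
        (fun j => F.roots.toFinset.filter (fun x => x ∈ Icc (p j.castSucc) (p j.succ))) := by
    intro x hx
    rw [Finset.mem_filter, Multiset.mem_toFinset, mem_roots hF0] at hx
    rcases le_or_gt x (p 0) with h0 | h0
    · exact absurd hx.1 (hbelow x hx.2 h0)
    rcases le_or_gt (p (Fin.last N)) x with hN | hN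
    · exact absurd hx.1 (habove x hN)
    obtain ⟨j, hj1, hj2⟩ := exists_window_of_chain p h0.le hN
    rw [Finset.mem_biUnion]
    refine ⟨j, Finset.mem_univ _, ?_⟩
    rw [Finset.mem_filter, Multiset.mem_toFinset, mem_roots hF0]
    exact ⟨hx.1, hj1, hj2⟩
  calc (F.roots.toFinset.filter (fun x => 0 < x)).card
      ≤ ((Finset.univ : Finset (Fin N)).biUnion
          (fun j => F.roots.toFinset.filter (fun x => x ∈ Icc (p j.castSucc) (p j.succ)))).card :=
        Finset.card_le_card hsub
    _ ≤ ∑ j, (F.roots.toFinset.filter (fun x => x ∈ Icc (p j.castSucc) (p j.succ))).card :=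
        Finset.card_biUnion_le
    _ ≤ ∑ j, B j := Finset.sum_le_sum fun j _ => hwin j

end Summit.ValiantsHypothesis.ValiantsHypothesis.Theorems.LacunarySymmetroidMatrixDescartes.Overlap
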